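import Summits.BirchSwinnertonDyer.BirchSwinnertonDyer.Theorems.SignedLowerHalvesKobayashiLowerHalfLargeImageKuriharaRigidityThm74Odd
import Summits.BirchSwinnertonDyer.Rank1Residual.Supersingular.KobayashiMainConjectureKuriharaRigidityThree
import Literature.NumberTheory.EllipticCurves.CuspFormLFunctionLevelConductorProofs
import HarnessLib

/-!
# Line `kurihara_rigidity` at `p = 3`: the lead's composite binder «Kim–Kim–Sun Thm 1.1 at 3 ∘ Kobayashi 7.4»
# (`KimKimSun2020_thm11_via_kobayashi74_three`) DERIVED from KKS Thm 1.1 read on the `η = 1` package, with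
# Kobayashi Thm 7.4 IN THE KERNEL at `p = 3` (crux `KobayashiLowerHalfLargeImage` = item
# stmt-BirchSwinnertonDyer-19001, stub `stub_three`; cell `bsd-ssimc`, seat `bsd-line-slh-p1-w2` g2, the lead gen 2's
# 07:32Z offer; `--supports … --as helper`)

WHAT. The lead (gen 2) brought `p = 3` onto the Kurihara road: `KimKimSun2020_thm11_via_kobayashi74_three`
(`Rank1Residual/Supersingular/KobayashiMainConjectureKuriharaRigidityThree.lean`, p611880) = «KKS Selecta 2020 Thm 1.1
AT `p = 3` (printed "`p > 2`"; flag `KKS20@3-MR-H4` displayed) ∘ Kobayashi 2003 Thm 7.4», in the ± currency, with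
Kobayashi's theorem on faith inside the composite — exactly the shape of the gen-0 binders at `p ≥ 5` that this seat
derived from finer facts (p608118/p608428). THIS FILE is the same second layer at `3`:
`kimKimSun2020_thm11_via_kobayashi74_three_of_katoFrame` derives the composite from the DISPLAYED frame `hKKS3` =
VERBATIM the body of the Literature statement `KimKimSun2020.thm11_katoMainIdentity_of_kuriharaNumber_ne_zero_three_OPEN`
(KKS Thm 1.1 at `3` read on the package — typed `_OPEN`/claim-grade because the printed proof's Lemma 4.3 takes
Mazur–Rubin (H.4b) `p > 4`; repair = Sakamoto 2022/2024 [PUB, artinian] + C.-H. Kim 2025 Thm 3.18 [PRE, Λ-adic];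
proposed with this file, p614127) + Kobayashi Thm 1.2 + the two period facts, through the lead's KERNEL Thm 7.4 at
odd `p` (`kobayashiMainConjecture_of_katoMainConjectureFrame_odd`, `…KuriharaRigidityThm74Odd`, p612293). The
newform of the binder (any level `N`) is identified with the conjecture's newform at level `N_E` by Atkin–Lehner
strong multiplicity one (`IsNewformOf.level_eq_level`, `IsNewformOf.unique`), as in the `p ≥ 5` layer.

TRUST BASE of the `p = 3`, `3 ∤ Tam` road after this file (numbers, not adjectives): {KKS Thm 1.1 at 3 on the
package [claim-grade per flag `KKS20@3-MR-H4`], Kobayashi Thm 1.2, the period facts [PUBLISHED]} + the line's open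
statement at 3 (`X4.KuriharaUnitAt W 3 f`, Kurihara's [C] at 3, Σ⁰₁ per pair) — Kobayashi 7.4 in the kernel.
HONEST FRAMING (cell `bsd-ssimc`, D-0036/D-0074): TOOL THEOREM ONLY — no definition, no named fact minted, no `sorry`,
axioms standard; CONDITIONAL on the displayed `hKKS3`, `h12`, `h5`, `h3`; `stub_three`, the crux and the route are
NOT closed; nothing is booked; BSD is not proved by any of this. `--supports stmt-BirchSwinnertonDyer-19001 --as helper`.

References: [KimKimSun2020] Thm 1.1, (Tam) p. 4, §1.3, Lemma 4.3, §7.4; [Kobayashi2003] Thm 1.2, Thm 7.4 (p. 13);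
[Sakamoto2024KolyvaginThree] Thm 1.1; [Kim2025RefinedTNC] §3.2.2, Thm 3.18; [MazurRubin2004] (H.4), Thm 5.3.10;
[GreenbergVatsal2000] §3 Rem 3.4; [Mazur1978] Cor 4.1; [AtkinLehner1970] Thm 4.
-/

set_option autoImplicit false
-- single-problem summit (D-0017): the doubled namespace component is by design
set_option linter.dupNamespace false

noncomputable section

open scoped Classical MatrixGroups ModularForm

open CongruenceSubgroup Field WeierstrassCurve Literature.NumberTheory.EllipticCurves
  Literature.NumberTheory.EllipticCurves.ModularForms Literature.NumberTheory.GaloisRepresentations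
  Literature.NumberTheory.EllipticCurves.Rank1Residual Summit.BirchSwinnertonDyer.Rank1Residual.Supersingular
  Summit.BirchSwinnertonDyer.Rank1Residual.X4

namespace Summit.BirchSwinnertonDyer.BirchSwinnertonDyer.Theorems.KuriharaRigidity

/-- **`KimKimSun2020_thm11_via_kobayashi74_three` DERIVED.** Displayed hypothesis `hKKS3` = VERBATIM the body of the
Literature statement `KimKimSun2020.thm11_katoMainIdentity_of_kuriharaNumber_ne_zero_three_OPEN` (Kim–Kim–Sun Selecta
2020 Thm 1.1 for `f = f_E` at `p = 3` read on the `η = 1` package: good `3`, `a₃ = 0`, `ρ̄` onto + the `3`-adic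
tower onto, (Tam)'s first clause on the multiplicative primes, the period transfer, a unit Kurihara number at a
CYCLIC Kolyvagin level ⟹ for every sign and all pinned `I`, `Y` some package datum `d` with `char_Λ Y.X =
char_Λ(I.H ⧸ d.Z)`; claim-grade at `3`, flag `KKS20@3-MR-H4`); `h12` = Kobayashi Thm 1.2; `h5`, `h3` = the period
facts. CONCLUSION: the lead's composite binder (its (Tam) predicate `KimKimSun2020TamAt W 3` unfolds to `hKKS3`'s
displayed clause). Proof: unfold the binder and `KobayashiMainConjecture`; the conjecture's newform `f'` at level
`N_E` IS the certificate's newform `f` (`IsNewformOf.level_eq_level`, `IsNewformOf.unique`); `E[3]` irreducible from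
`ρ̄` onto; then the lead's `kobayashiMainConjecture_of_katoMainConjectureFrame_odd` (Kobayashi Thm 7.4 (ii) in the
kernel at odd `p`) on the frame supplied by `hKKS3`. CONDITIONAL on `hKKS3`, `h12`, `h5`, `h3`; closes nothing.
[cite: KimKimSun2020, Thm. 1.1 and (Tam) (p. 4), §7.4] [cite: Kobayashi2003, Thm. 7.4 (p. 13), Thm. 1.2 (p. 2)]
[cite: AtkinLehner1970, Thm. 4] [cite: GreenbergVatsal2000, §3, Remark 3.4] -/
theorem kimKimSun2020_thm11_via_kobayashi74_three_of_katoFrame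
    (hKKS3 : ∀ (W : WeierstrassCurve ℚ) [W.IsElliptic] [W.IsGloballyMinimal] (p : ℕ) [Fact p.Prime]
        [ContinuousSMul ℤ_[p] (W.tateModule p)] [Module.Free ℤ_[p] (W.tateModule p)]
        [Module.Finite ℤ_[p] (W.tateModule p)]
        {N : ℕ} [NeZero N] (f : CuspForm (Gamma0 N) 2) (ϖ : ℚ)
        (κ : ZpExtension ℚ p) (γ : absoluteGaloisGroup ℚ),
        p = 3 → W.HasGoodReductionAtPrime p → W.frobeniusTrace p = 0 → IsNewformOf W f →
        (ϖ : ℝ) * W.realPeriodRat = plusPeriod f →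
        κ.IsCyclotomic → κ.IsTopGenerator γ → IsCyclotomicVariable p γ →
        W.HasSurjectiveModNGaloisRep p → (∀ n : ℕ, W.HasSurjectiveModNGaloisRep (p ^ n : ℕ)) →
        (∀ (q : ℕ) [Fact q.Prime], W.HasMultiplicativeReductionAtPrime q →
          (W.HasSplitMultiplicativeReductionAtPrime q → ¬ p ∣ q - 1) ∧
          (¬ W.HasSplitMultiplicativeReductionAtPrime q → ¬ p ∣ q + 1)) →
        (∃ u : ℚ, ‖(u : ℚ_[p])‖ = 1 ∧ W.realPeriodRat = u * plusPeriod f) →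
      ∀ (n : ℕ) [NeZero n], Kato.IsKolyvaginProduct W p 1 n →
        (∀ (ℓ : ℕ) [Fact ℓ.Prime], ℓ ∣ n →
          Nat.card {P : ((WeierstrassCurve.integralModelInt W).map
              (Int.castRingHom (ZMod ℓ))).toAffine.Point // p • P = 0} ≤ p) →
      ∀ ψ : (ℓ : ℕ) → (ZMod ℓ)ˣ →* Multiplicative (ZMod (p ^ 1)),
        (∀ ℓ ∈ n.primeFactors, Function.Surjective (ψ ℓ)) →
        kuriharaNumber f (p ^ 1) n ψ ≠ 0 →
      ∀ (ε : ℤˣ) (I : Kato2004.IwasawaH1Data W p κ γ) (Y : W.FineSelmerDualData κ γ),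
        ∃ d : Kobayashi2003.SignedColemanKatoData W p f ϖ κ γ ε I,
          Module.charIdeal (IwasawaAlgebra p) Y.X =
            Module.charIdeal (IwasawaAlgebra p) (I.H ⧸ d.Z))
    (h12 : Kobayashi2003.thm12_signedSelmerDual_finite_torsion)
    (h5 : realPeriodRat_eq_unit_mul_plusPeriod) (h3 : realPeriodRat_eq_unit_mul_plusPeriod_three) :
    KimKimSun2020_thm11_via_kobayashi74_three := by
  intro W _ _ p _ hp3 hgood hap hs htower htam N _ f hf hper hunit ε
  have hp2 : p ≠ 2 := by omega
  haveI : ContinuousSMul ℤ_[p] (W.tateModule p) := TateModule.continuousSMul_padicInt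
  haveI : Module.Free ℤ_[p] (W.tateModule p) := W.module_free_tateModule_holds p
  haveI : Module.Finite ℤ_[p] (W.tateModule p) := W.module_finite_tateModule_holds p
  have hirr : W.HasIrreducibleModPGaloisRep p :=
    hasIrreducibleModPGaloisRep_of_hasSurjectiveModNGaloisRep W p hs
  refine kobayashiMainConjecture_of_katoMainConjectureFrame_odd W p h12 h5 h3 hp2 hgood hap hirr ε ?_
  intro κ γ hκ hγ hγc _ f' hf' ϖ hϖ I Y
  -- the conjecture's newform `f'` (level `N_E`) is the certificate's newform `f` (level `N`)
  obtain ⟨n, hn0, hn, hcyc, ψ, hψ, hne⟩ := hunit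
  haveI : NeZero n := hn0
  have hN : N = W.conductorNorm ℤ := hf.level_eq_level hf'
  subst hN
  have hff : f = f' := hf.unique hf'
  subst hff
  exact hKKS3 W p f ϖ κ γ hp3 hgood hap hf hϖ hκ hγ hγc hs htower htam hper n hn
    (fun ℓ _ hℓ => hcyc ℓ hℓ) ψ hψ hne ε I Y

end Summit.BirchSwinnertonDyer.BirchSwinnertonDyer.Theorems.KuriharaRigidity

end
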